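import Literature.AlgebraicGeometry.HodgeTheory.GysinKernelSplit
import Literature.AlgebraicGeometry.HodgeTheory.GysinKernelWeights
import Literature.AlgebraicGeometry.HodgeTheory.ComplexPointsLocallyContractible
import Literature.AlgebraicTopology.SingularHomology.SphereLikeFibre
import Mathlib.Topology.JacobsonSpace
import HarnessLib

/-!
# Deligne, *Hodge III*, Prop. 8.2.7 (the named fact `Deligne1974_ker_pullback_eq_ker_pullback_resolution`)
# from mixed Hodge structures with Prop. 8.2.5 — the topological input discharged

Theorems-only companion of `GysinKernelSplit.lean` (the named fact
`Deligne1974_ker_pullback_eq_ker_pullback_resolution`: P. Deligne, *Théorie de Hodge III*,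
Publ. Math. IHÉS 44 (1974), Prop. 8.2.7 in Čech form — for `X` smooth projective over `ℂ` and a
finite family `g j : Y j ⟶ X` from smooth projective `Y j`, a class `x' ∈ Hᵠ(X(ℂ); ℂ)` killed by
every `(g j)(ℂ)^*` vanishes on an open neighbourhood of `{P | pt P ∈ ⋃ j, g_j(Y j)}`) and of
`GysinKernelWeights.lean` (the printed proof of Cor. 8.2.8 run inside the tree's mixed-Hodge
vocabulary from THREE inputs: a package `M : Motives.MixedHodgeStructureOfPair ℂ` of mixed Hodge
structures on the cohomology of pairs — the named fact `MixedHodgeStructureOfPair.existsDeligne` —,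
Deligne's Prop. 8.2.5 for it (`h825`), and the local contractibility of complex algebraic sets
(`hLC`)).

Since then the third input has been PROVED in the tree, unconditionally:
`locallyContractibleSpace_complexPoints_of_isSmoothProjective` (`ComplexPointsLocallyContractible`,
from the proved semialgebraic triangulation theorem, Ohmoto–Shiota Thm. 2.2 / Łojasiewicz 1964).
This file records the resulting state of the discharge of Prop. 8.2.7: the named fact follows
from the mixed Hodge structures together with Prop. 8.2.5 ALONE, by the printed proof (p. 40:
"c) Pour `i = n`, ces noyaux sont égaux car `Gr^W_n(π^*)` est injectif (8.2.5.2)", with purity of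
`Hⁿ` of the smooth projective target and strictness, Hodge II Thm. 2.3.5 (iii)):

* `Deligne1974_ker_pullback_eq_ker_pullback_resolution_of_mixedHodgeStructure` — from `M` and
  Prop. 8.2.5 in the weakest form the proof uses: for closed subschemes `Z ↪ X` of smooth
  projective varieties (so `Z` is projective) and finite jointly surjective families
  `π j : Y j ⟶ Z` from smooth projective varieties, the classes of `Hᵠ(Z(ℂ); ℚ)` killed by every
  `(π j)^*` lie in `W_{q-1}` ("le quotient de poids `n` de `Hⁿ(X, ℚ)` est l'image de `Hⁿ(X, ℚ)`
  dans `Hⁿ(Y, ℚ)`", Prop. 8.2.5, read with Thm. 8.2.4 (iii), `W_n Hⁿ(X) = Hⁿ(X)` for `X` proper);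
* `Deligne1974_ker_pullback_eq_ker_pullback_resolution_of_mixedHodgeStructure_of_proper` — the
  same with Prop. 8.2.5 quantified over all proper varieties `Z`, verbatim the hypothesis `h825`
  of `Deligne1974_ker_restrictCompl_eq_iSup_range_complexGysin_of_mixedHodgeStructure`;
* `Deligne1974_ker_restrictCompl_eq_iSup_range_complexGysin_of_mixedHodgeStructure'` — Cor. 8.2.8
  (the parent named fact) from `M` and `h825`, without `hLC`.

What remains of the discharge of `Deligne1974_ker_pullback_eq_ker_pullback_resolution` is exactly
mixed Hodge theory: an inhabitant of `Motives.MixedHodgeStructureOfPair ℂ` (the named fact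
`existsDeligne`, Hodge II–III) satisfying Prop. 8.2.5, which is a property of Deligne's
construction by proper hypercoverings ((8.2.5.2)) and is NOT a consequence of the axioms of the
package (they bound the Hodge numbers of `Hⁿ` by the box `[0, n]²` only, not by `p + q ≤ n` for
proper varieties, Thm. 8.2.4 (iii)). No definitions, no named facts here.

## References

* [DeligneHodgeIII1974] P. Deligne, Théorie de Hodge III, Publ. Math. IHÉS 44 (1974), Thm. 8.2.4,
  Prop. 8.2.5, Prop. 8.2.7, Cor. 8.2.8 (pp. 38–40).
* [DeligneHodgeII1971] P. Deligne, Théorie de Hodge II, Publ. Math. IHÉS 40 (1971), Thm. 2.3.5 (iii).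
* [OhmotoShiota2017] T. Ohmoto, M. Shiota, C¹-triangulations of semialgebraic sets, J. Topology 10
  (2017), Thm. 2.2.
* [Spanier1981] E. H. Spanier, Algebraic Topology, Springer 1981, Ch. 6 §1 Thm. 10.
-/

noncomputable section

open CategoryTheory AlgebraicGeometry
open Literature.AlgebraicTopology.SingularHomology

namespace Literature.AlgebraicGeometry.HodgeTheory

open Literature.AlgebraicGeometry.Motives

/-- **Deligne, *Hodge III*, Prop. 8.2.7 (Čech form, the named fact
`Deligne1974_ker_pullback_eq_ker_pullback_resolution`) from mixed Hodge structures with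
Prop. 8.2.5.** Let `M` be a package of mixed Hodge structures on the rational cohomology of pairs
of `ℂ`-varieties (`Motives.MixedHodgeStructureOfPair ℂ`, the content of `existsDeligne`) and assume
for it Prop. 8.2.5 in the form the proof uses (`h825`): for `X` smooth projective, `i : Z ↪ X` a
closed subscheme and `π j : Y j ⟶ Z` a finite, jointly surjective family from smooth projective
varieties, every `y ∈ Hᵠ(Z(ℂ); ℚ) = Hᵠ((Z, ∅))` killed by all `(π j)^*` lies in `W_{q-1}`. Then the
named fact holds: a complex class `x' ∈ Hᵠ(X(ℂ); ℂ)` killed by every `(g j)(ℂ)^*` vanishes on an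
open neighbourhood of `{P | pt P ∈ ⋃ j, g_j(Y j)}`. Proof as printed (p. 40): factor the `g j`
through the closed subscheme `Z` carried by the joint image (`exists_closedSubscheme_factor`);
`i^* v ∈ W_{q-1} ∩ i^*(Hᵠ(X)) = 0` for rational `v` by purity of `Hᵠ(X)` and strictness
(`singularCohomology_map_rat_eq_zero_of_W`); tensor with `ℂ` (`complexBetti_map_eq_zero_of_rat`);
pass to the germ of `Z(ℂ)` by tautness (`exists_isOpen_map_subsetIncl_eq_zero_of_complexBetti_map_eq_zero`),
the local contractibility of `Z(ℂ)` being the tree's unconditional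
`locallyContractibleSpace_complexPoints_of_isSmoothProjective`.
[cite: DeligneHodgeIII1974, Prop. 8.2.7 (proof c), p. 40) and Prop. 8.2.5] -/
theorem Deligne1974_ker_pullback_eq_ker_pullback_resolution_of_mixedHodgeStructure
    (M : MixedHodgeStructureOfPair ℂ)
    (h825 : ∀ ⦃n : ℕ⦄ ⦃X : Motives.SchemeOver ℂ⦄, IsSmoothProjective n X →
      ∀ ⦃Z : Motives.SchemeOver ℂ⦄ (i : Z ⟶ X), IsClosedImmersion i.left →
      ∀ ⦃ι : Type⦄ [Finite ι] ⦃m : ι → ℕ⦄ ⦃Y : ι → Motives.SchemeOver ℂ⦄,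
        (∀ j, IsSmoothProjective (m j) (Y j)) → ∀ (π : ∀ j, Y j ⟶ Z),
        (⋃ j, Set.range (π j).left.base) = Set.univ →
        ∀ (q : ℕ) (y : (SchemePair.ofScheme Z).bettiCohomology q),
          (∀ j, SchemePair.bettiCohomology.map (SchemePair.Hom.ofScheme (π j)) q y = 0) →
            y ∈ (M.mhs (SchemePair.ofScheme Z) q).W ((q : ℤ) - 1)) :
    Deligne1974_ker_pullback_eq_ker_pullback_resolution := by
  intro n X hX ι _ m Y hY g q x' hx'
  obtain ⟨Z, i, hi, π, hπ, hrange⟩ := exists_closedSubscheme_factor hX hY g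
  haveI := hi
  -- the family `π` is jointly surjective onto `Z`
  have hsurj : (⋃ j, Set.range (π j).left.base) = Set.univ := by
    refine Set.eq_univ_of_forall fun z ↦ ?_
    have hz : i.left.base z ∈ ⋃ j, Set.range (g j).left.base := hrange ▸ ⟨z, rfl⟩
    obtain ⟨j, y, hy⟩ := Set.mem_iUnion.1 hz
    refine Set.mem_iUnion.2 ⟨j, y, i.left.isClosedEmbedding.injective ?_⟩
    change ((π j ≫ i).left).base y = i.left.base z
    rw [hπ j]
    exact hy
  -- Prop. 8.2.7 over `ℚ`: purity of `Hᵠ(X)`, Prop. 8.2.5 for `⊔ Y j → Z`, strictness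
  have hQ : ∀ v : singularCohomology ℚ ℚ (ComplexPoints X) q,
      (∀ j, singularCohomology.map ℚ ℚ (AlgPoints.mapContinuous (L := ℂ) (g j)) q v = 0) →
        singularCohomology.map ℚ ℚ (AlgPoints.mapContinuous (L := ℂ) i) q v = 0 :=
    fun v hv ↦ singularCohomology_map_rat_eq_zero_of_W M hX g i π hπ q
      (h825 hX i hi hY π hsurj q) v hv
  -- `⊗ ℂ`, then tautness of `Z(ℂ)` in `X(ℂ)` (local contractibility: proved in the tree)
  have hvan := complexBetti_map_eq_zero_of_rat hX g i q hQ x' hx'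
  obtain ⟨V, hVo, hKV, hV⟩ := exists_isOpen_map_subsetIncl_eq_zero_of_complexBetti_map_eq_zero
    hX i (locallyContractibleSpace_complexPoints_of_isSmoothProjective hX _
      i.left.isClosedEmbedding.isClosed_range) x' hvan
  refine ⟨V, hVo, ?_, hV⟩
  rw [← hrange]
  exact hKV

/-- **Prop. 8.2.7 from mixed Hodge structures with Prop. 8.2.5 as printed (all proper `Z`).**
The same, with Prop. 8.2.5 assumed in its printed generality — for every proper variety `Z` and
every finite jointly surjective family `π j : Y j ⟶ Z` from smooth projective varieties
("Supposons `X` propre. Si `π : Y → X` est un morphisme propre surjectif, avec `Y` lisse, alors le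
quotient de poids `n` de `Hⁿ(X, ℚ)` est l'image de `Hⁿ(X, ℚ)` dans `Hⁿ(Y, ℚ)`"), verbatim the
hypothesis `h825` of `Deligne1974_ker_restrictCompl_eq_iSup_range_complexGysin_of_mixedHodgeStructure`:
a closed subscheme of a smooth projective variety is a proper variety
(`isVarietyPair_and_isProper_of_isClosedImmersion`).
[cite: DeligneHodgeIII1974, Prop. 8.2.5 and Prop. 8.2.7] -/
theorem Deligne1974_ker_pullback_eq_ker_pullback_resolution_of_mixedHodgeStructure_of_proper
    (M : MixedHodgeStructureOfPair ℂ)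
    (h825 : ∀ ⦃Z : Motives.SchemeOver ℂ⦄, (SchemePair.ofScheme Z).IsVarietyPair → IsProper Z.hom →
      ∀ ⦃ι : Type⦄ [Finite ι] ⦃m : ι → ℕ⦄ ⦃Y : ι → Motives.SchemeOver ℂ⦄,
        (∀ j, IsSmoothProjective (m j) (Y j)) → ∀ (π : ∀ j, Y j ⟶ Z),
        (⋃ j, Set.range (π j).left.base) = Set.univ →
        ∀ (q : ℕ) (y : (SchemePair.ofScheme Z).bettiCohomology q),
          (∀ j, SchemePair.bettiCohomology.map (SchemePair.Hom.ofScheme (π j)) q y = 0) →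
            y ∈ (M.mhs (SchemePair.ofScheme Z) q).W ((q : ℤ) - 1)) :
    Deligne1974_ker_pullback_eq_ker_pullback_resolution := by
  refine Deligne1974_ker_pullback_eq_ker_pullback_resolution_of_mixedHodgeStructure M ?_
  intro _ _ hX _ i hi _ _ _ _ hY π hsurj q y hy
  haveI := hi
  obtain ⟨hZv, hZp⟩ := isVarietyPair_and_isProper_of_isClosedImmersion hX i
  exact h825 hZv hZp hY π hsurj q y hy

/-- **Cor. 8.2.8 (the parent named fact `Deligne1974_ker_restrictCompl_eq_iSup_range_complexGysin`)
from mixed Hodge structures with Prop. 8.2.5, the local contractibility discharged**: the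
hypothesis `hLC` of `Deligne1974_ker_restrictCompl_eq_iSup_range_complexGysin_of_mixedHodgeStructure`
is the tree's theorem `locallyContractibleSpace_complexPoints_of_isSmoothProjective`; assembled
through the split `Deligne1974_ker_restrictCompl_eq_iSup_range_complexGysin_holds_of`
("(8.2.8.1) est la suite transposée de (8.2.8.2) par dualité de Poincaré").
[cite: DeligneHodgeIII1974, Cor. 8.2.8 (proof, p. 40)] -/
theorem Deligne1974_ker_restrictCompl_eq_iSup_range_complexGysin_of_mixedHodgeStructure'
    (M : MixedHodgeStructureOfPair ℂ)
    (h825 : ∀ ⦃Z : Motives.SchemeOver ℂ⦄, (SchemePair.ofScheme Z).IsVarietyPair → IsProper Z.hom →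
      ∀ ⦃ι : Type⦄ [Finite ι] ⦃m : ι → ℕ⦄ ⦃Y : ι → Motives.SchemeOver ℂ⦄,
        (∀ j, IsSmoothProjective (m j) (Y j)) → ∀ (π : ∀ j, Y j ⟶ Z),
        (⋃ j, Set.range (π j).left.base) = Set.univ →
        ∀ (q : ℕ) (y : (SchemePair.ofScheme Z).bettiCohomology q),
          (∀ j, SchemePair.bettiCohomology.map (SchemePair.Hom.ofScheme (π j)) q y = 0) →
            y ∈ (M.mhs (SchemePair.ofScheme Z) q).W ((q : ℤ) - 1)) :
    Deligne1974_ker_restrictCompl_eq_iSup_range_complexGysin :=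
  Deligne1974_ker_restrictCompl_eq_iSup_range_complexGysin_holds_of
    (Deligne1974_ker_pullback_eq_ker_pullback_resolution_of_mixedHodgeStructure_of_proper M h825)

/-! ### Prop. 8.2.5 in degree `0`, for every package: joint pull-backs on `H⁰` are injective -/

section DegreeZero

universe u

/-- **Complex points over the image of a morphism lift**: for a morphism `π : Y ⟶ Z` of
`ℂ`-schemes locally of finite type and a complex point `P` of `Z` whose underlying (closed) point
lies in the image of `π`, there is a complex point `Q` of `Y` with `π(Q) = P`: the fibre of `π` over
the closed point `pt P` is a non-empty closed subset of the Jacobson space `Y`, so it contains a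
closed point, i.e. a complex point (Nullstellensatz, the tree's `ComplexPoints.equivClosedPoints`),
and complex points are determined by their underlying points (Mumford, *Red Book*, I §10; the
argument of the tree's `AlgPoints.map_surjective_of_surjective`). [folklore] -/
theorem AlgPoints.exists_map_eq_of_pt_mem_range {Y Z : Motives.SchemeOver ℂ} (π : Y ⟶ Z)
    [LocallyOfFiniteType Y.hom] [LocallyOfFiniteType Z.hom] (P : ComplexPoints Z)
    (hP : P.pt ∈ Set.range π.left.base) : ∃ Q : ComplexPoints Y, AlgPoints.map π Q = P := by
  haveI : JacobsonSpace ↥Y.left := LocallyOfFiniteType.jacobsonSpace Y.hom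
  have hcl : IsClosed (π.left ⁻¹' ({P.pt} : Set Z.left)) :=
    (ComplexPoints.isClosed_pt P).preimage π.left.continuous
  obtain ⟨x, hx⟩ := hP
  obtain ⟨q, hq, hqc⟩ := nonempty_inter_closedPoints (X := ↥Y.left) ⟨x, hx⟩ hcl.isLocallyClosed
  refine ⟨(ComplexPoints.equivClosedPoints Y).symm ⟨q, hqc⟩, ?_⟩
  apply (ComplexPoints.equivClosedPoints Z).injective
  apply Subtype.ext
  rw [ComplexPoints.coe_equivClosedPoints_apply, ComplexPoints.coe_equivClosedPoints_apply,
    AlgPoints.pt_map]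
  have hq' : ((ComplexPoints.equivClosedPoints Y).symm ⟨q, hqc⟩).pt = q := by
    have := ComplexPoints.coe_equivClosedPoints_apply Y ((ComplexPoints.equivClosedPoints Y).symm ⟨q, hqc⟩)
    rw [Equiv.apply_symm_apply] at this
    exact this.symm
  rw [hq']
  exact Set.mem_singleton_iff.mp (Set.mem_preimage.mp hq)

/-- **Joint pull-backs on `H⁰` along a jointly surjective family are injective**: if continuous
maps `f i : T i → S` are jointly surjective and a class `c ∈ H⁰(S; M)` dies under every `(f i)^*`,
then `c = 0` — a `0`-cocycle is a function on points and there are no coboundaries in degree `0`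
(the tree's `singularCohomology.eq_zero_of_forall_map_const_eq_zero`: classes of `H⁰` are
detected by points), and every point of `S` factors through some `f i`.
[cite: HatcherAT2002, §3.1 p. 199] -/
theorem singularCohomology_zero_eq_zero_of_forall_map_eq_zero {R : Type} [CommRing R]
    {N : Type} [AddCommGroup N] [Module R N] {S : Type u} [TopologicalSpace S] {ι : Type*}
    {T : ι → Type u} [∀ i, TopologicalSpace (T i)] (f : ∀ i, C(T i, S))
    (hf : ∀ s : S, ∃ i, ∃ t : T i, f i t = s) (c : singularCohomology R N S 0)
    (hc : ∀ i, singularCohomology.map R N (f i) 0 c = 0) : c = 0 := by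
  refine singularCohomology.eq_zero_of_forall_map_const_eq_zero R N c fun s ↦ ?_
  obtain ⟨i, t, rfl⟩ := hf s
  have e : ContinuousMap.const PUnit.{u + 1} (f i t) =
      (f i).comp (ContinuousMap.const PUnit.{u + 1} t) := by
    ext
    rfl
  rw [e, singularCohomology.map_comp, ModuleCat.comp_apply, hc i, map_zero]

/-- **Prop. 8.2.5 in degree `0` (for every package, indeed without Hodge theory)**: for a
`ℂ`-scheme `Z` locally of finite type and a finite jointly surjective family `π j : Y j ⟶ Z` of
`ℂ`-schemes locally of finite type, a class `y ∈ H⁰((Z, ∅)) = H⁰(Z(ℂ); ℚ)` killed by every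
`(π j)^*` is zero: joint surjectivity on scheme points gives joint surjectivity on complex points
(`AlgPoints.exists_map_eq_of_pt_mem_range`), and `H⁰` is detected by points
(`singularCohomology_zero_eq_zero_of_forall_map_eq_zero`), transported along `absIso`.
[cite: DeligneHodgeIII1974, Prop. 8.2.5] [cite: HatcherAT2002, §3.1 p. 199] -/
theorem SchemePair.bettiCohomology_zero_eq_zero_of_forall_map_eq_zero {Z : Motives.SchemeOver ℂ}
    [LocallyOfFiniteType Z.hom] {ι : Type} {Y : ι → Motives.SchemeOver ℂ}
    [∀ j, LocallyOfFiniteType (Y j).hom] (π : ∀ j, Y j ⟶ Z)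
    (hsurj : (⋃ j, Set.range (π j).left.base) = Set.univ)
    (y : (SchemePair.ofScheme Z).bettiCohomology 0)
    (hy : ∀ j, SchemePair.bettiCohomology.map (SchemePair.Hom.ofScheme (π j)) 0 y = 0) : y = 0 := by
  apply (ConcreteCategory.bijective_of_isIso (SchemePair.absIso Z 0).hom).1
  rw [map_zero]
  refine singularCohomology_zero_eq_zero_of_forall_map_eq_zero (T := fun j ↦ ComplexPoints (Y j))
    (fun j ↦ AlgPoints.mapContinuous (L := ℂ) (π j)) (fun P ↦ ?_) _ fun j ↦ ?_
  · have hP : P.pt ∈ ⋃ j, Set.range (π j).left.base := hsurj ▸ Set.mem_univ _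
    obtain ⟨j, hj⟩ := Set.mem_iUnion.1 hP
    obtain ⟨Q, hQ⟩ := AlgPoints.exists_map_eq_of_pt_mem_range (π j) P hj
    exact ⟨j, Q, hQ⟩
  · rw [← absIso_hom_map_ofScheme, hy j, map_zero]

/-- **Prop. 8.2.7 from mixed Hodge structures with Prop. 8.2.5 in POSITIVE degrees.** As
`Deligne1974_ker_pullback_eq_ker_pullback_resolution_of_mixedHodgeStructure`, with the hypothesis
`h825` required only in degrees `q + 1 ≥ 1`: in degree `0` it holds for every package
(`SchemePair.bettiCohomology_zero_eq_zero_of_forall_map_eq_zero`: the class is even `0`). The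
positive degrees are the Mayer–Vietoris induction of Thm. 8.2.4 (iii) / Prop. 8.2.5 (its steps
on the package: `Motives/MixedHodgeStructureOfPairMayerVietoris`).
[cite: DeligneHodgeIII1974, Prop. 8.2.7 (proof c), p. 40) and Prop. 8.2.5] -/
theorem Deligne1974_ker_pullback_eq_ker_pullback_resolution_of_mixedHodgeStructure_succ
    (M : MixedHodgeStructureOfPair ℂ)
    (h825 : ∀ ⦃n : ℕ⦄ ⦃X : Motives.SchemeOver ℂ⦄, IsSmoothProjective n X →
      ∀ ⦃Z : Motives.SchemeOver ℂ⦄ (i : Z ⟶ X), IsClosedImmersion i.left →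
      ∀ ⦃ι : Type⦄ [Finite ι] ⦃m : ι → ℕ⦄ ⦃Y : ι → Motives.SchemeOver ℂ⦄,
        (∀ j, IsSmoothProjective (m j) (Y j)) → ∀ (π : ∀ j, Y j ⟶ Z),
        (⋃ j, Set.range (π j).left.base) = Set.univ →
        ∀ (q : ℕ) (y : (SchemePair.ofScheme Z).bettiCohomology (q + 1)),
          (∀ j, SchemePair.bettiCohomology.map (SchemePair.Hom.ofScheme (π j)) (q + 1) y = 0) →
            y ∈ (M.mhs (SchemePair.ofScheme Z) (q + 1)).W (((q + 1 : ℕ) : ℤ) - 1)) :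
    Deligne1974_ker_pullback_eq_ker_pullback_resolution := by
  refine Deligne1974_ker_pullback_eq_ker_pullback_resolution_of_mixedHodgeStructure M ?_
  intro n X hX Z i hi ι _ m Y hY π hsurj q y hy
  cases q with
  | zero =>
    haveI := hi
    haveI : LocallyOfFiniteType Z.hom :=
      (isVarietyPair_and_isProper_of_isClosedImmersion hX i).1.locallyOfFiniteType
    haveI : ∀ j, LocallyOfFiniteType (Y j).hom := fun j ↦
      (IsSmoothProjective.isVarietyPair_ofScheme_holds (hY j)).locallyOfFiniteType
    rw [SchemePair.bettiCohomology_zero_eq_zero_of_forall_map_eq_zero π hsurj y hy]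
    exact Submodule.zero_mem _
  | succ q => exact h825 hX i hi hY π hsurj q y hy

end DegreeZero

end Literature.AlgebraicGeometry.HodgeTheory

end
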